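import Literature.Computability.AlgebraicComplexity.BI17TensorDegreeMonoidPositive
import Literature.Computability.AlgebraicComplexity.TensorOrbitSeparation
import HarnessLib

/-!
# Separating a closed `SL³`-orbit from a closed `SL³`-stable set of 3-tensors by an invariant

GIT Ch. 1 §2 Cor. 1.2 ("disjoint closed invariant subsets are separated by an invariant") for the
group `SL_ι(ℂ)³` acting on `⊗³ℂ^ι`, in the vocabulary of Bürgisser–Ikenmeyer 2017
(`IsPolystableTensor`, `IsSL3Invariant`, `actTensor`, `tensorPt`; `BI17FundamentalInvariantTensors.lean`):

* `IsPolystableTensor.exists_isSL3Invariant_eq_one_of_forall_eq_zero`: for a polystable `w₀` and a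
  set `B` of tensors that is Zariski closed (cut out by some set of coordinate polynomials) and
  `SL³`-stable, with `w₀ ∉ B`, there is an `SL³`-invariant polynomial `q` with `q(w₀) = 1` and
  `q|_B = 0`. Proof, exactly as in the tree's separation of `SL³·w` from the origin
  (`exists_isSL3Invariant_aeval_tensorPt_ne_zero`, `BI17TensorDegreeMonoidPositive.lean`) and in the
  forms version `exists_isSLInvariantCoord_fermat_one_singular_zero`
  (`SingularFormsInvariantSeparation.lean`): the closed orbit `SL³·w₀` is Zariski closed
  (`IsPolystableTensor.zeroLocus_vanishingIdeal_subset`) and disjoint from `B`, so the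
  Nullstellensatz gives `a + b = 1` with `a ∈ I(SL³·w₀)`, `b ∈ I(B)`
  (`exists_mem_vanishingIdeal_add_eq_one_of_disjoint`), and the Reynolds splitting in the completely
  reducible `SL³`-module `ℂ[⊗³ℂ^ι]` (`tensorCoordRepSL_exists_fixed_add_eq_of_mem_sup`) makes `a, b`
  invariant; `q := b`.
* `IsSL3Invariant.aeval_tensorPt_eq_of_mem_closure_sl3Orbit`: an invariant takes the same value at
  every point of the classical closure of an orbit (continuity).

Brick T3 of the val-lit cell's programme #5 (tensor form of Popov's stability criterion,
`Popov1970_genericClosedOrbit_tensor` / `BI2017_prop_4_10`, architect's note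
`NOTE-t02g6-programme5-tensor-popov70-sizing.md`): with `B` = the tensors with a non-trivial
`𝔰𝔩³` Lie stabiliser (brick T2) and `w₀` = an explicit stable tensor (brick T4), the invariant `q`
is non-zero at Zariski-generic `w`, constant on orbit closures, hence closure points of a generic
orbit avoid `B`, and brick T1 (`TripleOrbitClosedOfNoFixedTorus.lean`) closes the orbit.

Theorem-only file (no definitions, no named facts). Honest framing: classical invariant theory of
the toy module `⊗³ℂ^m` (bookkeeping for rows POP70-B / BI2017-B); nothing here bears on VP versus
VNP, which is NOT proved anywhere in this tree.

## References

* D. Mumford, J. Fogarty, F. Kirwan, *Geometric Invariant Theory*, 3rd ed., Springer (1994),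
  Ch. 1 §2, Cor. 1.2 (separation of disjoint closed invariant sets by invariants) and Ch. 1 §1,
  Def. 1.5 (Reynolds operator). [MumfordFogartyKirwan1994]
* P. Bürgisser, C. Ikenmeyer, *Fundamental invariants of orbit closures*, J. Algebra 477 (2017),
  §2.2, §4.2, §5 (the invariant ring `O(⊗³ℂ^m)^{SL_m^3}`), proof of Prop. 4.10. [BurgisserIkenmeyer2017]
-/

noncomputable section

open MvPolynomial
open scoped Matrix Topology

namespace Literature.Computability.AlgebraicComplexity

section Separation

variable {ι : Type*} [Fintype ι] [DecidableEq ι]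

omit [Fintype ι] [DecidableEq ι] in
/-- Every point of `⊗³ℂ^ι` in coordinates is `tensorPt` of a tensor (un-currying).
[cite: BurgisserIkenmeyer2017, §5.1 (coordinates `w_{abc}`)] -/
theorem exists_eq_tensorPt (x : ι × ι × ι → ℂ) : ∃ w : ι → ι → ι → ℂ, tensorPt w = x :=
  ⟨fun a b c => x (a, b, c), funext fun _ => rfl⟩

/-- The ideal of a Zariski-closed, `SL³`-stable set of tensors (read in coordinates) is stable under
`tensorCoordRepSL` (`(h·F)(w) = F(hᵀ·w)`). [cite: BurgisserIkenmeyer2017, §5 (the action of `SL_m^3` on `O(⊗³ℂ^m)`, TeX L1981)] -/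
theorem tensorCoordRepSL_mem_vanishingIdeal_of_stable {B : Set (ι → ι → ι → ℂ)}
    (hBst : ∀ (g : Matrix.SpecialLinearGroup ι ℂ × Matrix.SpecialLinearGroup ι ℂ ×
        Matrix.SpecialLinearGroup ι ℂ) (w : ι → ι → ι → ℂ), w ∈ B →
      actTensor (g.1 : Matrix ι ι ℂ) (g.2.1 : Matrix ι ι ℂ) (g.2.2 : Matrix ι ι ℂ) w ∈ B)
    (h : Matrix.SpecialLinearGroup ι ℂ × Matrix.SpecialLinearGroup ι ℂ × Matrix.SpecialLinearGroup ι ℂ)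
    {F : MvPolynomial (ι × ι × ι) ℂ} (hF : F ∈ MvPolynomial.vanishingIdeal ℂ (tensorPt '' B)) :
    tensorCoordRepSL ι h F ∈ MvPolynomial.vanishingIdeal ℂ (tensorPt '' B) := by
  rw [MvPolynomial.mem_vanishingIdeal_iff] at hF ⊢
  rintro _ ⟨w, hw, rfl⟩
  rw [tensorCoordRepSL_apply, aeval_tensorPt_tensorCoordSubst]
  exact hF _ ⟨_, hBst (h.1.transpose, h.2.1.transpose, h.2.2.transpose) w hw, rfl⟩

omit [Fintype ι] [DecidableEq ι] in
/-- A set of tensors cut out by coordinate polynomials is Zariski closed in coordinates: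
`Z(I(B)) ⊆ B`. [cite: MumfordFogartyKirwan1994, Ch. 1 §2 (closed invariant subsets)] -/
theorem zeroLocus_vanishingIdeal_subset_image_tensorPt_of_cutOut {B : Set (ι → ι → ι → ℂ)}
    (hBcl : ∃ T : Set (MvPolynomial (ι × ι × ι) ℂ), ∀ w, w ∈ B ↔ ∀ Φ ∈ T, aeval (tensorPt w) Φ = 0) :
    MvPolynomial.zeroLocus ℂ (MvPolynomial.vanishingIdeal ℂ (tensorPt '' B)) ⊆ tensorPt '' B := by
  obtain ⟨T, hT⟩ := hBcl
  intro x hx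
  rw [MvPolynomial.mem_zeroLocus_iff] at hx
  obtain ⟨w, rfl⟩ := exists_eq_tensorPt x
  refine ⟨w, (hT w).2 fun Φ hΦ => hx Φ ?_, rfl⟩
  rw [MvPolynomial.mem_vanishingIdeal_iff]
  rintro _ ⟨w', hw', rfl⟩
  exact (hT w').1 hw' Φ hΦ

/-- **Separation of a closed `SL³`-orbit from a closed `SL³`-stable set by an invariant** (GIT Ch. 1
§2 Cor. 1.2 for `SL_ι(ℂ)³` on `⊗³ℂ^ι`): if `w₀` is polystable, `B` is cut out by coordinate
polynomials and `SL³`-stable, and `w₀ ∉ B`, then some `SL³`-invariant polynomial `q` has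
`q(w₀) = 1` and vanishes on `B`. Nullstellensatz (`exists_mem_vanishingIdeal_add_eq_one_of_disjoint`)
+ Reynolds (`tensorCoordRepSL_exists_fixed_add_eq_of_mem_sup`).
[cite: MumfordFogartyKirwan1994, Ch. 1 §2 Cor. 1.2; BurgisserIkenmeyer2017, proof of Prop. 4.10 (use)] -/
theorem IsPolystableTensor.exists_isSL3Invariant_eq_one_of_forall_eq_zero [Nonempty ι]
    {w₀ : ι → ι → ι → ℂ} (hw₀ : IsPolystableTensor w₀) {B : Set (ι → ι → ι → ℂ)}
    (hBcl : ∃ T : Set (MvPolynomial (ι × ι × ι) ℂ), ∀ w, w ∈ B ↔ ∀ Φ ∈ T, aeval (tensorPt w) Φ = 0)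
    (hBst : ∀ (g : Matrix.SpecialLinearGroup ι ℂ × Matrix.SpecialLinearGroup ι ℂ ×
        Matrix.SpecialLinearGroup ι ℂ) (w : ι → ι → ι → ℂ), w ∈ B →
      actTensor (g.1 : Matrix ι ι ℂ) (g.2.1 : Matrix ι ι ℂ) (g.2.2 : Matrix ι ι ℂ) w ∈ B)
    (hw₀B : w₀ ∉ B) :
    ∃ q : MvPolynomial (ι × ι × ι) ℂ, IsSL3Invariant q ∧ aeval (tensorPt w₀) q = 1 ∧
      ∀ w ∈ B, aeval (tensorPt w) q = 0 := by
  classical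
  set O : Set (ι → ι → ι → ℂ) := Set.range fun g :
      Matrix.SpecialLinearGroup ι ℂ × Matrix.SpecialLinearGroup ι ℂ × Matrix.SpecialLinearGroup ι ℂ =>
    actTensor (g.1 : Matrix ι ι ℂ) (g.2.1 : Matrix ι ι ℂ) (g.2.2 : Matrix ι ι ℂ) w₀ with hO
  -- the two Zariski-closed sets, in coordinates
  have h₁ : MvPolynomial.zeroLocus ℂ (MvPolynomial.vanishingIdeal ℂ (tensorPt '' O)) ⊆ tensorPt '' O :=
    hw₀.zeroLocus_vanishingIdeal_subset
  have h₂ := zeroLocus_vanishingIdeal_subset_image_tensorPt_of_cutOut hBcl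
  -- they are disjoint: the orbit avoids the stable set `B` (else `w₀ = g⁻¹ · (g · w₀) ∈ B`)
  have hdisj : Disjoint (tensorPt '' O) (tensorPt '' B) := by
    rw [Set.disjoint_image_iff tensorPt_injective, Set.disjoint_left]
    rintro _ ⟨g, rfl⟩ hgB
    apply hw₀B
    have h := hBst g⁻¹ _ hgB
    rw [actTensor_actTensor] at h
    have e1 : (((g⁻¹).1 : Matrix.SpecialLinearGroup ι ℂ) : Matrix ι ι ℂ) * (g.1 : Matrix ι ι ℂ) = 1 := by
      rw [Prod.fst_inv, ← Matrix.SpecialLinearGroup.coe_mul, inv_mul_cancel,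
        Matrix.SpecialLinearGroup.coe_one]
    have e2 : (((g⁻¹).2.1 : Matrix.SpecialLinearGroup ι ℂ) : Matrix ι ι ℂ) * (g.2.1 : Matrix ι ι ℂ) = 1 := by
      rw [Prod.snd_inv, Prod.fst_inv, ← Matrix.SpecialLinearGroup.coe_mul, inv_mul_cancel,
        Matrix.SpecialLinearGroup.coe_one]
    have e3 : (((g⁻¹).2.2 : Matrix.SpecialLinearGroup ι ℂ) : Matrix ι ι ℂ) * (g.2.2 : Matrix ι ι ℂ) = 1 := by
      rw [Prod.snd_inv, Prod.snd_inv, ← Matrix.SpecialLinearGroup.coe_mul, inv_mul_cancel,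
        Matrix.SpecialLinearGroup.coe_one]
    rwa [e1, e2, e3, actTensor_one] at h
  -- Nullstellensatz: `a + b = 1`
  obtain ⟨a, ha, b, hb, hab⟩ :=
    Literature.Computability.AlgebraicComplexity.exists_mem_vanishingIdeal_add_eq_one_of_disjoint
      h₁ h₂ hdisj
  -- Reynolds splitting in the completely reducible `SL³`-module `ℂ[⊗³]`
  let J₁ : Subrepresentation (tensorCoordRepSL ι) :=
    ⟨(MvPolynomial.vanishingIdeal ℂ (tensorPt '' O)).restrictScalars ℂ,
      fun h F hF => tensorCoordRepSL_mem_vanishingIdeal_sl3Orbit w₀ h hF⟩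
  let J₂ : Subrepresentation (tensorCoordRepSL ι) :=
    ⟨(MvPolynomial.vanishingIdeal ℂ (tensorPt '' B)).restrictScalars ℂ,
      fun h F hF => tensorCoordRepSL_mem_vanishingIdeal_of_stable hBst h hF⟩
  have h1 : (1 : MvPolynomial (ι × ι × ι) ℂ) ∈ J₁.toSubmodule ⊔ J₂.toSubmodule :=
    hab ▸ Submodule.add_mem_sup ha hb
  have h1inv : ∀ g, tensorCoordRepSL ι g 1 = 1 := fun g => by rw [tensorCoordRepSL_apply, map_one]
  obtain ⟨a', ha', b', hb', -, hb'inv, hab'⟩ :=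
    tensorCoordRepSL_exists_fixed_add_eq_of_mem_sup J₁ J₂ h1 h1inv
  refine ⟨b', (isSL3Invariant_iff_forall_tensorCoordRepSL_eq b').2 hb'inv, ?_, fun w hw => ?_⟩
  · -- `b'(w₀) = 1 - a'(w₀) = 1`
    have hwO : tensorPt w₀ ∈ tensorPt '' O :=
      ⟨w₀, ⟨1, by simp only [Prod.fst_one, Prod.snd_one, Matrix.SpecialLinearGroup.coe_one,
        actTensor_one]⟩, rfl⟩
    have ha'w : aeval (tensorPt w₀) a' = 0 := (MvPolynomial.mem_vanishingIdeal_iff.1 ha') _ hwO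
    have := congrArg (aeval (tensorPt w₀)) hab'
    rwa [map_add, map_one, ha'w, zero_add] at this
  · -- `b'` vanishes on `B`
    exact (MvPolynomial.mem_vanishingIdeal_iff.1 hb') _ ⟨w, hw, rfl⟩

end Separation

/-! ### Invariants are constant on orbit closures -/

section Closure

variable {ι : Type*} [Fintype ι] [DecidableEq ι]

/-- **An `SL³`-invariant polynomial takes the same value at every point of the classical closure of
an orbit** (`q` is constant on `SL³·w`, and `w' ↦ q(w')` is continuous). This is how brick T5 of the
programme uses T3: closure points `w'` of `SL³·w` with `q(w) ≠ 0` have `q(w') ≠ 0`.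
[cite: BurgisserIkenmeyer2017, §2.2 (invariants are constant on orbit closures); MumfordFogartyKirwan1994, Ch. 1 §2] -/
theorem IsSL3Invariant.aeval_tensorPt_eq_of_mem_closure_sl3Orbit {q : MvPolynomial (ι × ι × ι) ℂ}
    (hq : IsSL3Invariant q) {w w' : ι → ι → ι → ℂ}
    (hw' : w' ∈ closure (Set.range fun g : Matrix.SpecialLinearGroup ι ℂ ×
        Matrix.SpecialLinearGroup ι ℂ × Matrix.SpecialLinearGroup ι ℂ =>
      actTensor (g.1 : Matrix ι ι ℂ) (g.2.1 : Matrix ι ι ℂ) (g.2.2 : Matrix ι ι ℂ) w)) :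
    aeval (tensorPt w') q = aeval (tensorPt w) q := by
  have hcont : Continuous fun v : ι → ι → ι → ℂ => aeval (tensorPt v) q := by
    have : (fun v : ι → ι → ι → ℂ => aeval (tensorPt v) q) =
        fun v => MvPolynomial.eval (tensorPt v) q := by
      funext v
      rfl
    rw [this]
    exact (MvPolynomial.continuous_eval q).comp continuous_tensorPt
  have hclosed : IsClosed {v : ι → ι → ι → ℂ | aeval (tensorPt v) q = aeval (tensorPt w) q} :=
    isClosed_eq hcont continuous_const
  have hsub : (Set.range fun g : Matrix.SpecialLinearGroup ι ℂ ×
        Matrix.SpecialLinearGroup ι ℂ × Matrix.SpecialLinearGroup ι ℂ =>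
      actTensor (g.1 : Matrix ι ι ℂ) (g.2.1 : Matrix ι ι ℂ) (g.2.2 : Matrix ι ι ℂ) w) ⊆
      {v : ι → ι → ι → ℂ | aeval (tensorPt v) q = aeval (tensorPt w) q} := by
    rintro _ ⟨g, rfl⟩
    exact hq g.1 g.2.1 g.2.2 w
  exact hclosed.closure_subset_iff.mpr hsub hw'

/-- Hence: if `q` is `SL³`-invariant, `q(w) ≠ 0`, and `q` vanishes on a set `B`, then NO point of the
classical closure of `SL³·w` lies in `B`. [cite: MumfordFogartyKirwan1994, Ch. 1 §2 Cor. 1.2 (use); BurgisserIkenmeyer2017, proof of Prop. 4.10] -/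
theorem IsSL3Invariant.not_mem_of_mem_closure_sl3Orbit {q : MvPolynomial (ι × ι × ι) ℂ}
    (hq : IsSL3Invariant q) {B : Set (ι → ι → ι → ℂ)} (hqB : ∀ v ∈ B, aeval (tensorPt v) q = 0)
    {w w' : ι → ι → ι → ℂ} (hqw : aeval (tensorPt w) q ≠ 0)
    (hw' : w' ∈ closure (Set.range fun g : Matrix.SpecialLinearGroup ι ℂ ×
        Matrix.SpecialLinearGroup ι ℂ × Matrix.SpecialLinearGroup ι ℂ =>
      actTensor (g.1 : Matrix ι ι ℂ) (g.2.1 : Matrix ι ι ℂ) (g.2.2 : Matrix ι ι ℂ) w)) :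
    w' ∉ B := fun hB =>
  hqw ((hq.aeval_tensorPt_eq_of_mem_closure_sl3Orbit hw').symm.trans (hqB w' hB))

end Closure

/-! ### Packaged for the assembly: generically, orbit closures avoid `B` -/

section Generic

variable {ι : Type*} [Fintype ι] [DecidableEq ι]

/-- **Generic orbit closures avoid a closed stable set missed by one closed orbit.** If `B` is cut
out by coordinate polynomials and `SL³`-stable, and some polystable `w₀ ∉ B`, then for
Zariski-generic `w ∈ ⊗³ℂ^ι` NO point of the classical closure of `SL³·w` lies in `B` (the generic
set is `{q ≠ 0}` for the separating invariant `q` of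
`IsPolystableTensor.exists_isSL3Invariant_eq_one_of_forall_eq_zero`). The form consumed by the
assembly brick T5 (with `B` = tensors with non-trivial `𝔰𝔩³` Lie stabiliser).
[cite: MumfordFogartyKirwan1994, Ch. 1 §2 Cor. 1.2; BurgisserIkenmeyer2017, proof of Prop. 4.10] -/
theorem IsPolystableTensor.isZariskiGenericTensor_closure_sl3Orbit_not_mem [Nonempty ι]
    {w₀ : ι → ι → ι → ℂ} (hw₀ : IsPolystableTensor w₀) {B : Set (ι → ι → ι → ℂ)}
    (hBcl : ∃ T : Set (MvPolynomial (ι × ι × ι) ℂ), ∀ w, w ∈ B ↔ ∀ Φ ∈ T, aeval (tensorPt w) Φ = 0)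
    (hBst : ∀ (g : Matrix.SpecialLinearGroup ι ℂ × Matrix.SpecialLinearGroup ι ℂ ×
        Matrix.SpecialLinearGroup ι ℂ) (w : ι → ι → ι → ℂ), w ∈ B →
      actTensor (g.1 : Matrix ι ι ℂ) (g.2.1 : Matrix ι ι ℂ) (g.2.2 : Matrix ι ι ℂ) w ∈ B)
    (hw₀B : w₀ ∉ B) :
    IsZariskiGenericTensor fun w : ι → ι → ι → ℂ =>
      ∀ w' ∈ closure (Set.range fun g : Matrix.SpecialLinearGroup ι ℂ ×
          Matrix.SpecialLinearGroup ι ℂ × Matrix.SpecialLinearGroup ι ℂ =>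
        actTensor (g.1 : Matrix ι ι ℂ) (g.2.1 : Matrix ι ι ℂ) (g.2.2 : Matrix ι ι ℂ) w), w' ∉ B := by
  obtain ⟨q, hq, hq1, hqB⟩ := hw₀.exists_isSL3Invariant_eq_one_of_forall_eq_zero hBcl hBst hw₀B
  refine ⟨q, fun h0 => ?_, fun w hw w' hw' => hq.not_mem_of_mem_closure_sl3Orbit hqB hw hw'⟩
  rw [h0, map_zero] at hq1
  exact zero_ne_one hq1

/-- **Predicate form, in the exact shape consumed by the assembly** (`TensorMumfordStability`,
val-lit-t09): for a property `P` of tensors whose FAILURE set is cut out by coordinate polynomials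
and `SL³`-stable, one polystable tensor `w₀` with `P w₀` yields a non-zero `SL³`-invariant `q`
vanishing wherever `P` fails. Used with `P = HasTrivialSL3LieStabilizer` (brick T2: the failure set
is the common zero set of the maximal minors of the Lie-stabiliser matrix) and `w₀` = the generic
witness of brick T4. [cite: MumfordFogartyKirwan1994, Ch. 1 §2 Cor. 1.2; BurgisserIkenmeyer2017, proof of Prop. 4.10] -/
theorem IsPolystableTensor.exists_isSL3Invariant_ne_zero_of_not [Nonempty ι]
    {w₀ : ι → ι → ι → ℂ} (hw₀ : IsPolystableTensor w₀) {P : (ι → ι → ι → ℂ) → Prop}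
    (hPcl : ∃ T : Set (MvPolynomial (ι × ι × ι) ℂ), ∀ w, ¬ P w ↔ ∀ Φ ∈ T, aeval (tensorPt w) Φ = 0)
    (hPst : ∀ (g : Matrix.SpecialLinearGroup ι ℂ × Matrix.SpecialLinearGroup ι ℂ ×
        Matrix.SpecialLinearGroup ι ℂ) (w : ι → ι → ι → ℂ), ¬ P w →
      ¬ P (actTensor (g.1 : Matrix ι ι ℂ) (g.2.1 : Matrix ι ι ℂ) (g.2.2 : Matrix ι ι ℂ) w))
    (hPw₀ : P w₀) :
    ∃ q : MvPolynomial (ι × ι × ι) ℂ, IsSL3Invariant q ∧ q ≠ 0 ∧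
      ∀ w, ¬ P w → aeval (tensorPt w) q = 0 := by
  obtain ⟨q, hq, hq1, hqB⟩ := hw₀.exists_isSL3Invariant_eq_one_of_forall_eq_zero
    (B := {w | ¬ P w}) hPcl (fun g w hw => hPst g w hw) (fun h => h hPw₀)
  refine ⟨q, hq, fun h0 => ?_, fun w hw => hqB w hw⟩
  rw [h0, map_zero] at hq1
  exact zero_ne_one hq1

end Generic

end Literature.Computability.AlgebraicComplexity

end
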